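import Literature.Probability.LatticeModels.LatticeHarmonicCompactness
import HarnessLib

/-!
# Subsequential scaling limits of locally bounded lattice-harmonic functions — local form

Topic `Literature/Probability/LatticeModels` (discrete potential theory on `δℤ²` → continuum),
companion of `LatticeHarmonicCompactness.lean`. That file's compactness theorem
(`exists_subseq_tendstoUniformlyOn_of_latticeHarmonic`; D. Chelkak, S. Smirnov, Adv. Math. 228
(2011), Prop. 3.1 and proof of Thm. 3.13) asks the lattice functions `P n` to be harmonic at EVERY
site whose closed mesh `δ n`-disc lies in the open set `D`, for every `n`, and reads them at
`nearestSite`. Scaling limits of exactly Cauchy–Riemann lattice observables (whose real and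
imaginary parts are harmonic on each sublattice, `DiscreteCauchyRiemann.sum_edgeFun_zero_sub`)
deliver harmonicity only at DEEP sites — several meshes away from the discrete boundary — and only
for small mesh, and route statements read lattice functions at the floor site `⌊z/δ⌋`. This file
proves the same theorem in that form: harmonicity and boundedness are asked eventually in `n` and
only at sites with mesh point in each compact of `D`, and the reading map `read δ z` is any site
whose mesh point is within `2δ` of `z`
(`exists_subseq_tendstoUniformlyOn_of_latticeHarmonic_local`). The proof is the tree's, verbatim
up to constants (interior gradient estimate `abs_step_le_of_harmonic_box` and the extraction
theorem `exists_subseq_tendstoUniformlyOn_of_asympEquicontinuous`). Everything is proved,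
[folklore].
-/

noncomputable section

namespace Literature.Probability.LatticeModels

open _root_.Complex Metric Set Filter
open scoped _root_.Topology

/-- Sup-distance of two sites from the distance of their mesh points. [folklore] -/
private theorem abs_sub_le_of_norm_meshPoint_le_loc {δ : ℝ} (hδ : 0 < δ) {v v' : Site 2} {R : ℝ}
    (h : ‖meshPoint δ v - meshPoint δ v'‖ ≤ δ * R) :
    |((v 0 - v' 0 : ℤ) : ℝ)| ≤ R ∧ |((v 1 - v' 1 : ℤ) : ℝ)| ≤ R := by
  have hre := (abs_re_le_norm _).trans h
  have him := (abs_im_le_norm _).trans h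
  rw [sub_re, meshPoint_re, meshPoint_re, ← mul_sub, abs_mul, abs_of_pos hδ] at hre
  rw [sub_im, meshPoint_im, meshPoint_im, ← mul_sub, abs_mul, abs_of_pos hδ] at him
  push_cast
  exact ⟨le_of_mul_le_mul_left hre hδ, le_of_mul_le_mul_left him hδ⟩

/-- The **floor reading site** `⌊z/δ⌋ = (⌊Re z/δ⌋, ⌊Im z/δ⌋)` of a point of the plane at mesh `δ`
(the reading map of the route statements of `CriticalPhenomena/CardyFormulaZ2`). [folklore] -/
def floorSite (δ : ℝ) (z : ℂ) : Site 2 := fun j => ⌊(if j = 0 then z.re else z.im) / δ⌋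

/-- The floor reading site of a mesh point is the site itself. [folklore] -/
theorem floorSite_meshPoint {δ : ℝ} (hδ : δ ≠ 0) (x : Site 2) : floorSite δ (meshPoint δ x) = x := by
  funext j
  fin_cases j
  · simp [floorSite, meshPoint_re, mul_div_cancel_left₀ _ hδ]
  · simp [floorSite, meshPoint_im, mul_div_cancel_left₀ _ hδ]

/-- The mesh point of the floor reading site is within `2δ` of the point (in fact within `δ√2`).
[folklore] -/
theorem dist_meshPoint_floorSite_le {δ : ℝ} (hδ : 0 < δ) (z : ℂ) :
    dist (meshPoint δ (floorSite δ z)) z ≤ 2 * δ := by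
  have key : ∀ a : ℝ, |δ * (⌊a / δ⌋ : ℤ) - a| ≤ δ := fun a => by
    have h1 := Int.floor_le (a / δ)
    have h2 := Int.lt_floor_add_one (a / δ)
    rw [abs_le]
    constructor
    · have : ((⌊a / δ⌋ : ℤ) : ℝ) * δ > (a / δ - 1) * δ := by
        apply mul_lt_mul_of_pos_right _ hδ; linarith
      rw [sub_mul, div_mul_cancel₀ a hδ.ne', one_mul] at this
      linarith
    · have : ((⌊a / δ⌋ : ℤ) : ℝ) * δ ≤ a / δ * δ := mul_le_mul_of_nonneg_right h1 hδ.le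
      rw [div_mul_cancel₀ a hδ.ne'] at this
      linarith
  rw [Complex.dist_eq]
  refine (Complex.norm_le_abs_re_add_abs_im _).trans ?_
  simp only [sub_re, meshPoint_re, sub_im, meshPoint_im, floorSite]
  have h0 := key z.re
  have h1 := key z.im
  simp only [↓reduceIte, Fin.one_eq_zero_iff, OfNat.ofNat_ne_one] at h0 h1 ⊢
  linarith

/-- The mesh point of the nearest site is within `2δ` of the point. [folklore] -/
theorem dist_meshPoint_nearestSite_le_two {δ : ℝ} (hδ : 0 < δ) (z : ℂ) :
    dist (meshPoint δ (nearestSite δ z)) z ≤ 2 * δ :=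
  (dist_meshPoint_nearestSite_le hδ z).trans (by linarith)


/-- **Subsequential local uniform limits of locally bounded, locally-eventually lattice-harmonic
functions (local form).** Let `D` be open, `δ n → 0⁺`, and `P n : ℤ² → ℝ`; suppose that on each
compact `K ⊆ D`, eventually in `n`, `P n` is lattice-harmonic at every site with mesh point in `K`
and bounded there uniformly in `n`. Let `read δ z` be any reading site within `2δ` of `z` (e.g.
`nearestSite`, or the floor site `⌊z/δ⌋`). Then along a subsequence the step functions
`z ↦ P n (read (δ n) z)` converge uniformly on every compact subset of `D` to a function continuous
on `D`. This is `exists_subseq_tendstoUniformlyOn_of_latticeHarmonic` with harmonicity asked only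
eventually and on compacts (as delivered by scaling limits of exactly-CR lattice observables, whose
relations hold at deep stencils only), and a general reading map. (Chelkak–Smirnov 2011,
Prop. 3.1 / proof of Thm. 3.13.) [folklore] -/
theorem exists_subseq_tendstoUniformlyOn_of_latticeHarmonic_local {D : Set ℂ} (hD : IsOpen D)
    {δ : ℕ → ℝ} (hδ : ∀ n, 0 < δ n) (hδ0 : Tendsto δ atTop (𝓝 0)) (P : ℕ → Site 2 → ℝ)
    (read : ℝ → ℂ → Site 2) (hread : ∀ {d : ℝ}, 0 < d → ∀ z : ℂ, dist (meshPoint d (read d z)) z ≤ 2 * d)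
    (hharm : ∀ K ⊆ D, IsCompact K → ∀ᶠ n in atTop, ∀ v : Site 2,
      meshPoint (δ n) v ∈ K → latticeLaplacian (P n) v = 0)
    (hbdd : ∀ K ⊆ D, IsCompact K → ∃ M : ℝ, ∀ᶠ n in atTop, ∀ v : Site 2,
      meshPoint (δ n) v ∈ K → |P n v| ≤ M) :
    ∃ φ : ℕ → ℕ, StrictMono φ ∧ ∃ H : ℂ → ℝ, ContinuousOn H D ∧
      ∀ K ⊆ D, IsCompact K →
        TendstoUniformlyOn (fun n z => P (φ n) (read (δ (φ n)) z)) H atTop K := by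
  set u : ℕ → ℂ → ℂ := fun n z => ((P n (read (δ n) z) : ℝ) : ℂ) with hu
  -- a compact neighbourhood inside `D` of a compact `K ⊆ D`, with a bound there
  have hnbhd : ∀ K ⊆ D, IsCompact K → ∃ r > 0, cthickening r K ⊆ D ∧ IsCompact (cthickening r K) ∧
      ∃ M : ℝ, 0 ≤ M ∧ ∀ᶠ n in atTop, ∀ v : Site 2, meshPoint (δ n) v ∈ cthickening r K →
        |P n v| ≤ M ∧ latticeLaplacian (P n) v = 0 := by
    intro K hKD hK
    obtain ⟨r, hr, hrD⟩ := hK.exists_cthickening_subset_open hD hKD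
    obtain ⟨M, hM⟩ := hbdd _ hrD (hK.cthickening)
    have hH := hharm _ hrD (hK.cthickening)
    refine ⟨r, hr, hrD, hK.cthickening, max M 0, le_max_right _ _, ?_⟩
    filter_upwards [hM, hH] with n hn hn' v hv
    exact ⟨(hn v hv).trans (le_max_left _ _), hn' v hv⟩
  -- uniform bounds
  have hbdd' : ∀ K ⊆ D, IsCompact K → ∃ M : ℝ, ∀ᶠ n in atTop, ∀ z ∈ K, ‖u n z‖ ≤ M := by
    intro K hKD hK
    obtain ⟨r, hr, -, -, M, -, hM⟩ := hnbhd K hKD hK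
    refine ⟨M, ?_⟩
    filter_upwards [hM, hδ0.eventually (gt_mem_nhds (half_pos hr))] with n hn hnr z hz
    simp only [hu, norm_real, Real.norm_eq_abs]
    refine (hn _ ?_).1
    exact mem_cthickening_of_dist_le _ z _ _ hz ((hread (hδ n) z).trans (by linarith))
  -- asymptotic equicontinuity
  have hequi : ∀ K ⊆ D, IsCompact K → ∃ L : ℝ, 0 ≤ L ∧ ∀ᶠ n in atTop, ∀ z ∈ K, ∀ z' ∈ K,
      ‖u n z - u n z'‖ ≤ L * (‖z - z'‖ + 4 * δ n) := by
    intro K hKD hK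
    obtain ⟨r, hr, hrD, -, M, hM0, hM⟩ := hnbhd K hKD hK
    set ρ := r / 4 with hρ
    have hρ0 : 0 < ρ := by positivity
    set C := topGradConst with hC
    have hC0 : 0 < C := topGradConst_pos
    refine ⟨32 * (C + 1) * M / ρ, by positivity, ?_⟩
    filter_upwards [hM, hδ0.eventually (gt_mem_nhds (show 0 < ρ / 200 by positivity))] with n hn hnρ z hz z' hz'
    set d := δ n with hd
    have hd0 : 0 < d := hδ n
    -- the box scale
    set N := ⌊ρ / (2 * d)⌋₊ with hN
    have hNle : (N : ℝ) ≤ ρ / (2 * d) := Nat.floor_le (by positivity)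
    have hNge : ρ / (2 * d) - 1 ≤ N := by
      have := Nat.lt_floor_add_one (ρ / (2 * d)); linarith
    have hρd : 100 ≤ ρ / (2 * d) := by rw [le_div_iff₀ (by positivity)]; linarith
    have hN16 : 16 ≤ N := by
      have : (16 : ℝ) ≤ N := by linarith
      exact_mod_cast this
    have hNd : (N : ℝ) * d ≤ ρ / 2 := by
      have := (le_div_iff₀ (by positivity : (0 : ℝ) < 2 * d)).1 hNle
      linarith
    -- sites near `read z` are well inside `D`, where `|P n| ≤ M` and `P n` is harmonic
    set v := read d z with hv
    have hvz : dist (meshPoint d v) z ≤ 2 * d := hread hd0 z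
    have hnear : ∀ x : Site 2, |x 0 - v 0| ≤ N → |x 1 - v 1| ≤ N →
        closedBall (meshPoint d x) d ⊆ cthickening r K := by
      intro x hx0 hx1 p hp
      rw [mem_closedBall] at hp
      have hxv := dist_meshPoint_le_of_abs_le hd0.le hx0 hx1
      push_cast at hxv
      apply mem_cthickening_of_dist_le p z r K hz
      calc dist p z ≤ dist p (meshPoint d x) + dist (meshPoint d x) (meshPoint d v) + dist (meshPoint d v) z :=
            dist_triangle4 _ _ _ _
        _ ≤ d + d * (2 * N) + 2 * d := by linarith
        _ ≤ r := by nlinarith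
    have hharm' : ∀ x : Site 2, |x 0 - v 0| ≤ N → |x 1 - v 1| ≤ N → latticeLaplacian (P n) x = 0 :=
      fun x hx0 hx1 => (hn x (hnear x hx0 hx1 (mem_closedBall_self hd0.le))).2
    have hM' : ∀ x : Site 2, |x 0 - v 0| ≤ N → |x 1 - v 1| ≤ N → |P n x| ≤ M :=
      fun x hx0 hx1 => (hn x (hnear x hx0 hx1 (mem_closedBall_self hd0.le))).1
    -- the gradient bound on the box of radius `N/4 - 1`
    have hgrad : ∀ x : Site 2, |x 0 - v 0| ≤ (N / 4 : ℕ) - 1 → |x 1 - v 1| ≤ (N / 4 : ℕ) - 1 →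
        ∀ k : Fin 4, |P n (x + cornerUnit k) - P n x| ≤ 4 * C * M / N :=
      fun x hx0 hx1 k => abs_step_le_of_harmonic_box hN16 hharm' hM0 hM' hx0 hx1 k
    have hg0 : 0 ≤ 4 * C * M / N := by positivity
    have hgle : 4 * C * M / N ≤ 16 * C * M * d / ρ := by
      have hNpos : (0 : ℝ) < N := by exact_mod_cast (show 0 < N by omega)
      rw [div_le_div_iff₀ hNpos hρ0]
      have : ρ ≤ 4 * N * d := by
        have h1 : ρ / (2 * d) - 1 ≤ N := hNge
        rw [div_sub_one (by positivity), div_le_iff₀ (by positivity)] at h1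
        nlinarith
      nlinarith [mul_nonneg (mul_nonneg (by norm_num : (0:ℝ) ≤ 4) hC0.le) hM0]
    -- the two cases: close or far
    by_cases hclose : ‖z - z'‖ ≤ ρ / 16
    · set v' := read d z' with hv'
      have hv'z' : dist (meshPoint d v') z' ≤ 2 * d := hread hd0 z'
      have hvv' : ‖meshPoint d v' - meshPoint d v‖ ≤ d * ((‖z - z'‖ + 4 * d) / d) := by
        rw [mul_div_cancel₀ _ hd0.ne', ← dist_eq_norm]
        calc dist (meshPoint d v') (meshPoint d v) ≤ dist (meshPoint d v') z' + dist z' z + dist z (meshPoint d v) :=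
              dist_triangle4 _ _ _ _
          _ ≤ 2 * d + ‖z - z'‖ + 2 * d := by
              have e1 : dist z' z = ‖z - z'‖ := by rw [dist_comm, dist_eq_norm]
              have e2 : dist z (meshPoint d v) ≤ 2 * d := by rw [dist_comm]; exact hvz
              linarith [hv'z']
          _ = ‖z - z'‖ + 4 * d := by ring
      obtain ⟨h0, h1⟩ := abs_sub_le_of_norm_meshPoint_le_loc hd0 hvv'
      have hRle : (‖z - z'‖ + 4 * d) / d ≤ ((N / 4 : ℕ) : ℝ) - 1 := by
        have h4 : ((N : ℝ) - 3) / 4 ≤ ((N / 4 : ℕ) : ℝ) := by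
          have : (N : ℤ) ≤ 4 * ((N / 4 : ℕ) : ℤ) + 3 := by omega
          have : (N : ℝ) ≤ 4 * ((N / 4 : ℕ) : ℝ) + 3 := by exact_mod_cast this
          linarith
        rw [div_le_iff₀ hd0]
        have h5 : ρ / (2 * d) - 1 ≤ N := hNge
        rw [div_sub_one (by positivity), div_le_iff₀ (by positivity)] at h5
        have h6 : ((N : ℝ) - 3) / 4 * d ≤ ((N / 4 : ℕ) : ℝ) * d := mul_le_mul_of_nonneg_right h4 hd0.le
        linarith
      have h0' : |v' 0 - v 0| ≤ ((N / 4 : ℕ) : ℤ) - 1 := by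
        have : (|((v' 0 - v 0 : ℤ) : ℝ)|) ≤ ((N / 4 : ℕ) : ℝ) - 1 := h0.trans hRle
        exact_mod_cast this
      have h1' : |v' 1 - v 1| ≤ ((N / 4 : ℕ) : ℤ) - 1 := by
        have : (|((v' 1 - v 1 : ℤ) : ℝ)|) ≤ ((N / 4 : ℕ) : ℝ) - 1 := h1.trans hRle
        exact_mod_cast this
      have hkey := abs_sub_le_of_gradient hgrad h0' h1'
      simp only [hu, ← ofReal_sub, norm_real, Real.norm_eq_abs, ← hv, ← hv', ← hd]
      rw [abs_sub_comm]
      calc |P n v' - P n v| ≤ 4 * C * M / N * (|((v' 0 - v 0 : ℤ) : ℝ)| + |((v' 1 - v 1 : ℤ) : ℝ)|) := hkey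
        _ ≤ 16 * C * M * d / ρ * (2 * ((‖z - z'‖ + 4 * d) / d)) :=
            mul_le_mul hgle (by linarith) (by positivity) (by positivity)
        _ = 32 * C * M / ρ * (‖z - z'‖ + 4 * d) := by field_simp; ring
        _ ≤ 32 * (C + 1) * M / ρ * (‖z - z'‖ + 4 * d) := by
            apply mul_le_mul_of_nonneg_right _ (by positivity)
            apply div_le_div_of_nonneg_right _ hρ0.le
            nlinarith
    · push Not at hclose
      have hb : ∀ w ∈ K, ‖u n w‖ ≤ M := by
        intro w hw
        simp only [hu, norm_real, Real.norm_eq_abs]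
        refine (hn _ ?_).1
        apply mem_cthickening_of_dist_le _ w _ _ hw
        exact (hread hd0 w).trans (by linarith)
      calc ‖u n z - u n z'‖ ≤ ‖u n z‖ + ‖u n z'‖ := norm_sub_le _ _
        _ ≤ M + M := add_le_add (hb z hz) (hb z' hz')
        _ = 32 * M / ρ * (ρ / 16) := by field_simp; ring
        _ ≤ 32 * (C + 1) * M / ρ * (‖z - z'‖ + 4 * d) := by
            apply mul_le_mul _ (by linarith) (by positivity) (by positivity)
            apply div_le_div_of_nonneg_right _ hρ0.le
            nlinarith
  -- extraction
  have hε : Tendsto (fun n => 4 * δ n) atTop (𝓝 0) := by simpa using hδ0.const_mul 4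
  obtain ⟨φ, hφ, g, hgc, hg⟩ :=
    exists_subseq_tendstoUniformlyOn_of_asympEquicontinuous hD u (fun n => 4 * δ n) hε hbdd' hequi
  refine ⟨φ, hφ, fun z => (g z).re, continuous_re.comp_continuousOn hgc, fun K hKD hK => ?_⟩
  have h1 := Complex.reCLM.uniformContinuous.comp_tendstoUniformlyOn (hg K hKD hK)
  refine h1.congr (Eventually.of_forall fun n => ?_)
  intro z _
  simp [hu]

end Literature.Probability.LatticeModels
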